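import Mathlib
import HarnessLib
import HarnessLib.Audit
import Summits.FinalStateConjecture.Statement
import Literature.Geometry.Lorentzian.KerrData
import Literature.Geometry.Lorentzian.WeightedNorms
import Literature.Geometry.Lorentzian.ModelData
import Literature.Geometry.Lorentzian.InitialDataPullback
import Literature.Geometry.Lorentzian.TrappedSurface
import HarnessLib.Audit.Status.Attr

/-!
Route: RootDecompKerrBasinLadder

# Route RootDecompKerrBasinLadder — Root decomposition N1 «KerrBasinLadder» at a fixed tuple — FSC ⟺
perturbative ∧ near-extremal ∧ enclosed-core Kerr capture ∧ small-data dispersal ∧ extended-field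
residual

DECOMPOSITION CELL decomp-fsc (D-0178; doctrine D-0170/0171/0172), summit S =
`_root_.FinalStateConjecture` exactly as typed; LADDER rung 0 — NOTHING IN THIS FILE PROVES THE
FINAL STATE CONJECTURE. OR-SIBLING of the cell's file of record Theses/RootDecompCaptureCells.lean
(route-FinalStateConjecture-RootDecompCaptureCells, N5) and of Theses/RootDecompGermJunction.lean
(N3), Theses/RootDecompCausalCells.lean (N2), Theses/RootDecompAdjacencyCells.lean (N4); this file =
node N1 «KerrBasinLadder» (lens decomp-fsc-lens-1: a LADDER of model cells in the data space —
β-tubes, in the b-conormal weighted Sobolev distance `InitialDataSet.dataWeightedSobolevEDist s δ`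
after pull-back `InitialDataSet.comap` along a cocompact horizon-penetrating embedding of a Kerr
slice, around the sub-extremal Kerr data `Kerr.data M a r₀` with (spin, depth) window, plus the
Minkowski tube around `trivialData`), CLEARED[regime-fixed] by the critic decomp-fsc-crit-1-g0
2026-08-30T01:33:24Z (HOME/CRITIC-LEDGER.md row 01:33:24Z; HOME = run/shared/lean/pub/decomp-fsc):
«exact AND ∀ params ✓ necessity ✓ no EQUIV ✓; node COSTUME at degenerate params (H5) ⇒ birth must
fix (s ≥ 2, δ ∈ (−3/2,−1/2), β, β₀ > 0, 0 ≤ χ̄ < 1, 2 ≤ ρ̄ < ∞)». THIS BIRTH FIXES THE TUPLE (s, δ,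
β, χ̄, ρ̄, β₀) = (6, −1, 1, 9/10, 3, 1) (inside the critic's regime; s = 6 ≥ 2 so «perturbative» is
honest, δ = −1 the centre of the Christodoulou–Klainerman weight range, χ̄ = 9/10 so the collar is
genuinely near-extremal, ρ̄ = 3 = the instrumentable close-limit depth, β = β₀ = 1 absolute units
per lens (H2)); every piece is S-implied for EVERY tuple (kernel), so the choice moves content
between cells and never correctness. The whole AND/OR tree is kept in HOME/TREE.md.
ROOT AND-node (exact, kernel `summit_iff_cells` in the writer's folder/n1/Sketch.lean = lens
`summit_iff_split` specialised): S ⟺ PerturbativeCapture ∧ NearExtremalCapture ∧ EnclosedCoreCapture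
∧ SmallDataDispersal ∧ ExtendedFieldResidual — a FREE POPULATION SPLIT of the exceptional set by
MEMBERSHIP OF THE BASE DATUM in four model cells (Kerr window cells 𝒦(β, W) for W = perturbative
window χ ≤ χ̄ horizon-penetrating / near-extremal collar χ̄ < χ < 1 / enclosed-core shell ρ₊(χ) ≤ ρ
≤ ρ̄; Minkowski cell 𝓜(β₀)) and their common complement (residual); cure target P_Σ verbatim, tame
genericity verbatim (one end, order 1, whole punctured line). Tags: NearExtremalCapture
[WEAKER·COUNTS — kernel `nearExtremalCapture_of_summit`; not emptied by print for ANY β (no basin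
uniform as χ → 1: Hintz Rem. 13.2); leaf IDEA-NEEDED + BARRIER (AretakisInstability) +
INSTRUMENTABLE (degeneration rate of ε(χ))]; EnclosedCoreCapture [WEAKER·COUNTS — kernel; open from
the first shell rung; leaf IDEA-NEEDED + INSTRUMENTABLE (close-limit / NR, ρ̄ = 3); COSTUME only in
the limit ρ̄ → ∞, not at ρ̄ = 3]; ExtendedFieldResidual [WEAKER·RESIDUAL near-wholesale — kernel;
carries stmt-17269 / stmt-17308 content; INTERNAL NODE for gen ≥ 1]; PerturbativeCapture [WEAKER,
UNDECIDED→DECORATIVE only in the limit β → 0⁺ (print: Klainerman–Szeftel + GKS + Shen χ ≪ 1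
refereed; Hintz 2026 claim χ < 1), at β = 1 OPEN-as-typed by effectivity/scale only — critic: NOT
COUNTED; leaf ATTACKABLE (porting of `klainerman_szeftel_kerr_stability_small_a_cauchy` /
`hintz_kerr_stability_subextremal_cauchy`) + IDEA-NEEDED (effective ε)]; SmallDataDispersal [WEAKER,
DECORATIVE in the limit β₀ → 0⁺ (CK93 `christodoulou_klainerman_stability_minkowski_cauchy`) — NOT
COUNTED; leaf ATTACKABLE (porting) + effective part IDEA-NEEDED]. No EQUIV layer; all five binders
load-bearing (cone 5); no theorem-emptied cell at the typed tuple (critic T3/T4); root genericity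
tame/one end/whole line (T5). Writer typing: every item ONE line over EXISTING declarations
(`Kerr.slice`, `Kerr.data`, `Kerr.Facts`, `Kerr.SliceFacts`, `InitialDataSet.comap`,
`InitialDataSet.dataWeightedSobolevEDist`, `Minkowski.slice`, `trivialData`; P_Σ, the cell predicate
K W and Mink and the three windows inlined with `let`), folder/n1/Sketch.lean rc 0, 0 sorry, 0
warnings (closes by four nested case splits; necessity ×5; `summit_iff_cells`). Lens node file
HOME/decomp-fsc-lens-1/KerrBasinLadder.lean
sha256=0b66b5d383cca76ab13f48d14c4b3959a276ff255d5520c0dfd97895e6f55335 (critic-checked @0b66b5d3;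
NODE line 01:26:52Z) + NODE.md; instrument data HOME/census/COSTUME-CENSUS-v1.md
sha256=17660d2f90b581bafa564c3770aecf7145cb0a799b3c1f57b10d96f2c53a4c91 (rows PR1–PR4 printed
basins, F2 caution c1: cells open in a topology finer than wDist). Why this is novel: no prior route
grades the data space of the typed summit by an explicit ladder of b-conormal Kerr tubes indexed by
spin collar and DRESSING DEPTH ρ̄ — the depth parameter interpolates between Hintz's
horizon-penetrating class and the Kerr-ended class of route ExactKerrEnds and isolates
«near-extremal capture» and «enclosed strong-field core» as separately typed S-implied cells.
Lean: `PerturbativeCapture ∧ NearExtremalCapture ∧ EnclosedCoreCapture ∧ SmallDataDispersal ∧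
ExtendedFieldResidual` (the five decls of this file; exactness `summit_iff_cells` kernel-checked in
folder/n1/Sketch.lean)

## Assembly
Pure logic inside `closes` (folder/n1/glue.lean, 0 sorry): for an admissible exceptional datum d,
four nested case splits on membership of d in the perturbative, collar, shell and Minkowski cells;
the matching capture piece cures each case and ExtendedFieldResidual the complement; the cure «∀ c ≠
0, P_Σ (F c)» is repackaged as «F c ∉ {d ∈ 𝓓 | ¬P d}». Binders consumed: all five (cone 5). Converse
S ⟹ every binder by restriction (`…_of_summit` ×5); exactness `summit_iff_cells` (Sketch.lean) =
lens `summit_iff_split` at the fixed tuple.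

Rationale: WHY THIS LINE. A population split of the exceptional set with cure target P is free and exact
(critic `fsc_iff_cellSplit`; tame genericity is monotone and not ∧-closed, tree
`isTameChristodoulouGeneric_and_fails`), so the content is the choice of cells: here the level sets
of DISTANCE TO THE MODEL FAMILIES in the norm the printed stability theorems use (b-conormal
weighted Sobolev tubes: Christodoulou–Klainerman 1993 for Minkowski, Klainerman–Szeftel 2023 +
Giorgi–Klainerman–Szeftel arXiv:2205.14808 for slowly rotating Kerr, Hintz 2026 claim for the full
sub-extremal range, Dafermos–Holzegel–Rodnianski–Taylor 2021 for Schwarzschild), windowed by spin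
ratio and by how deep the Kerr dressing reaches (Corvino–Schoen 2006 / Kehle–Unger arXiv:2304.08455
gluing shows the shell cells are populated with arbitrary cores). Imported: weighted-Sobolev
perturbation theory of the model solutions as a GRADING of the data space, nothing conjectural. What
it does that prior routes do not: ExactKerrEnds conditions only the END (ρ̄ = ∞, δ-free); KerrBurial
/ QuietWindowCapture / EIHFluxBalance are all-data mechanisms; lens-5's capture cells sort by the
solution's FATE — this node sorts by the DATUM's position, making the near-extremal collar
(third-law / overspinning content, Sorce–Wald arXiv:1707.05862, Kehle–Unger arXiv:2211.15742) and
the enclosed core (close-limit regime, Price–Pullin gr-qc/9402039) separately attackable and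
instrumentable.

RANKED CRUXES. #2 NearExtremalCapture (crux) — PIECE rung 1a — NearExtremalCapture at (s, δ, β, χ̄,
ρ̄, β₀) = (6, −1, 1, 9/10, 3, 1) [WEAKER·COUNTS — critic CLEARED[regime-fixed] 2026-08-30T01:33:24Z:
«WEAKER·IDEA-NEEDED+BARRIER (counts)»; leaf IDEA-NEEDED + BARRIER (AretakisInstability prices any
uniform-ε approach) + INSTRUMENTABLE (near-extremal QNM damping ∝ √(1−χ), degeneration rate of
ε(χ))]. For every Σ and every admissible P_Σ-exceptional datum d lying in the near-extremal Kerr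
window cell — granted the vendored Kerr facts, some sub-extremal Kerr data (M, a, r₀) with 9/10 <
|a|/M < 1 and horizon-penetrating depth 1 − √(1−χ²) < r₀/M < 1 + √(1−χ²), and a smooth cocompact
open embedding θ of the Kerr slice into Σ along which θ^*d is b-conormal (finite H^s'_(−1) distance
at every order) and 1-close at order 6 to the Kerr data — there are one end e and a tame immersed
injective one-parameter family F of admissible data with F 0 = d whose members c ≠ 0 satisfy P_Σ.
[difficulty: open-problem] (why it might fail: no printed basin is uniform as χ → 1 and the extremal
limit carries the Aretakis / zero-damped-mode instability; a near-extremal datum could overspin or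
hover at extremality along every tame curve through it.) [arXiv:1707.05862, arXiv:2211.15742,
arXiv:1910.02854, Hintz2026, arXiv:1206.6598]
#3 EnclosedCoreCapture (crux) — PIECE rung 1b — EnclosedCoreCapture at (s, δ, β, χ̄, ρ̄, β₀) = (6,
−1, 1, 9/10, 3, 1) [WEAKER·COUNTS — critic: «WEAKER·IDEA-NEEDED·INSTRUMENTABLE (counts; COSTUME only
as ρ̄ → ∞)»; leaf INSTRUMENTABLE (close-limit / NR at ρ̄ = 3) + IDEA-NEEDED (large-data mechanism
confined to a compact core: trapped-surface formation inside the hoop, then rung 0)]. For every Σ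
and every admissible P_Σ-exceptional datum d lying in the enclosed-core shell cell — sub-extremal
Kerr dressing (b-conormal, 1-close at order 6, weight −1) along a cocompact embedded Kerr slice that
reaches only down to a sphere r₀ = ρM with 1 + √(1−χ²) ≤ ρ ≤ 3 (on or outside the horizon radius;
the core inside is arbitrary) — there are one end e and a tame immersed injective admissible
one-parameter family F with F 0 = d whose members c ≠ 0 satisfy P_Σ. [difficulty: open-problem] (why
it might fail: a strong-field core inside r ≤ 3M (near-critical packet inside its own hoop,
pre-merger binary) may form a naked singularity or a non-settling exterior robustly along tame
curves — no theorem controls any core below the dressing sphere.) [arXiv:2304.08455,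
arXiv:gr-qc/9402039, arXiv:0805.3880, CorvinoSchoen2006]
#4 ExtendedFieldResidual (crux) — PIECE residual — ExtendedFieldResidual at (s, δ, β, χ̄, ρ̄, β₀) =
(6, −1, 1, 9/10, 3, 1) [WEAKER·RESIDUAL near-wholesale — critic: «RESIDUAL near-wholesale
(17269/17308)»; INTERNAL NODE for gen ≥ 1 (multi-centre data, extended incoming radiation, rough
tails; rough-tail sub-leaf ATTACKABLE by gluing along tame curves, cf. route ExactKerrEnds item
TameEscapeToKerrEnds)]. For every Σ and every admissible P_Σ-exceptional datum d in NO model cell —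
not in the perturbative, collar or shell Kerr window cells at β = 1 and not in the Minkowski cell at
β₀ = 1 — there are one end e and a tame immersed injective admissible one-parameter family F with F
0 = d whose members c ≠ 0 satisfy P_Σ. [difficulty: open-problem] (why it might fail: this is weak
cosmic censorship plus final-state settling for genuinely extended large data (N ≥ 2 receding
configurations, extended incoming radiation): a robust naked singularity or eternal non-settling
dynamics far from every model tube kills it.) [DafermosLuk2017, Christodoulou1999,
CorvinoSchoen2006, arXiv:gr-qc/0702084]
#5 PerturbativeCapture (crux) — PIECE rung 0→1 — PerturbativeCapture at (s, δ, β, χ̄, ρ̄, β₀) = (6,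
−1, 1, 9/10, 3, 1) [WEAKER; critic: «DECORATIVE-by-claim (β → 0⁺) / UNDECIDED[effective ε],
ATTACKABLE (porting) — NOT COUNTED»; at the typed β = 1 OPEN only by effectivity of the printed ε(M,
χ) and scale non-covariance (lens H2); leaf ATTACKABLE (porting
`klainerman_szeftel_kerr_stability_small_a_cauchy`, `hintz_kerr_stability_subextremal_cauchy`
through the lens's `onCell_of_forall_settles`) + IDEA-NEEDED (effective basin radius)]. For every Σ
and every admissible P_Σ-exceptional datum d in the perturbative Kerr window cell (spin ratio ≤
9/10, horizon-penetrating depth, b-conormal and 1-close at order 6, weight −1, to sub-extremal Kerr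
data along a cocompact embedded Kerr slice), there are one end e and a tame immersed injective
admissible one-parameter family F with F 0 = d whose members c ≠ 0 satisfy P_Σ. [difficulty: XL]
(why it might fail: β = 1 is an absolute radius while every printed basin ε(M, χ) is inexplicit and
non-uniform; data 1-close to a small-mass Kerr anchor are relatively large perturbations and may
collapse further or radiate away the hole.) [KlainermanSzeftel2023, arXiv:2205.14808, Hintz2026,
arXiv:2104.08222]
#6 SmallDataDispersal (crux) — PIECE rung 0′ — SmallDataDispersal at (s, δ, β, χ̄, ρ̄, β₀) = (6, −1,
1, 9/10, 3, 1) [WEAKER; critic: «same (CK93) — NOT COUNTED»; DECORATIVE in the limit β₀ → 0⁺ by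
`christodoulou_klainerman_stability_minkowski_cauchy`; at β₀ = 1 open by effectivity only; leaf
ATTACKABLE (porting of gr.S07-cauchy) + effective part IDEA-NEEDED]. For every Σ and every
admissible P_Σ-exceptional datum d in the Minkowski cell (Σ globally a copy of ℝ³ via a surjective
smooth open embedding θ of the Minkowski slice, θ^*d b-conormal and 1-close at order 6, weight −1,
to the trivial data), there are one end e and a tame immersed injective admissible one-parameter
family F with F 0 = d whose members c ≠ 0 satisfy P_Σ. [difficulty: XL] (why it might fail: no
explicit Christodoulou–Klainerman radius is in print; β₀ = 1 in H^6_(−1) may exceed the true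
dispersive basin, letting some cell data collapse to a black hole whose settling is then the full
problem.) [ChristodoulouKlainerman1993, arXiv:2108.13379, LindbladRodnianski2010, Bieri2009]

TWO-LAYER PLAN. Foreseen (lens kernel `onCell_of_forall_settles`, `onCell_mono`,
`perturbativeCapture_anti`, `enclosedCoreCapture_anti`; not filed): PerturbativeCapture ⇐ (porting:
one-ended Σ ⊇ cocompact Kerr slice ↦ slice data; MGHD existence; `ConvergesToKerr ⟹ Settles`) + an
EFFECTIVE basin radius ≥ 1 at order 6 — the second input is the open part; SmallDataDispersal
likewise from CK93. Gen-1 split owed on ExtendedFieldResidual (rough tails by gluing ∣ multi-centre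
∣ extended radiation), where the sibling nodes' residual cells attach.

KILL CRITERIA. All five binders are S-implied in the kernel, so a refutation of any (an exceptional
datum 1-close to Kerr or to flat data with no tame escape curve; a robust naked singularity in a
shell-cell core) refutes the summit AS TYPED — route closes `refuted:<Decl>` and the statement audit
is alerted; no pivot inside this node. A different tuple is a different route (never restate in
place). Superseded if a sibling root decomposition absorbs the collar and shell cells with finer
content.

NOT DECOMPOSED YET. ExtendedFieldResidual (the residual) is not decomposed at birth (gen-1 internal
node); the porting layer under PerturbativeCapture / SmallDataDispersal is not filed (ATTACKABLE,
shared with every FSC route); no second tuple is filed (one fixed tuple per route).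

CHEAPEST FALSIFIER. NearExtremalCapture: census question «does any printed NONLINEAR result have a
basin uniform on χ ∈ (9/10, 1)?» — none ([corpus:arxiv-2302.06636 p.3] departures from Kerr
tantalised near extremality; Hintz Rem. 13.2 local uniformity only); a kill needs an overspinning
tame-open set. EnclosedCoreCapture: «a theorem settling ALL vacuum data equal to Kerr outside r =
3M?» — none (Kehle–Unger arXiv:2304.08455 constructs examples only); instrument = close-limit / NR
at ρ̄ = 3, unrun (kit_allowed = false for the writer). PerturbativeCapture / SmallDataDispersal:
«explicit ε in print?» — none; consistent. Residual: inherits WCC (stmt-17269) — no cheap kill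
known.

NUMBERS. Fixed tuple (s, δ, β, χ̄, ρ̄, β₀) = (6, −1, 1, 9/10, 3, 1): s = 6 (order of closeness), δ =
−1 (b-weight, CK range (−3/2, −1/2)), β = β₀ = 1 (absolute tube radii in `dataWeightedSobolevEDist 6
(−1)`), χ̄ = 9/10 (collar starts at spin ratio 0.9; NR remnant spins ≤ 0.95 on open sets,
arXiv:1904.04831), ρ̄ = 3 (dressing sphere at most at 3M, the Schwarzschild photon sphere;
close-limit regime gr-qc/9402039). Printed basins: ε(M, χ) inexplicit (KS 2023 Thm 1.2.1; Hintz 2026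
Thm 13.1), CK93 ε inexplicit.

DEFINITION REQUESTS. None filed. The Kerr window cell K W and the Minkowski cell are inlined `let`s
over Literature decls (`Kerr.data`, `InitialDataSet.comap`,
`InitialDataSet.dataWeightedSobolevEDist`, `trivialData`); if gen-1 reuses them, Literature-level
`InitialDataSet.IsKerrDressed s δ β W` / `IsNearTrivial s δ β₀` next to WeightedNorms would let the
items be restated by name (definitionally equal). Dedup vs Literature:
`InitialDataSet.HasExactKerrEnd` (ExactKerrEnds) is the δ-free ρ̄ = ∞ analogue, cited not reused.

Novelty: Searches (2026-08-30, lens-1 + writer): the sub's Theses files read for Kerr-tube / end-conditioned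
routes (nearest: ExactKerrEnds DRAFT — end only; KerrBurial, QuietWindowCapture, EIHFluxBalance —
all-data mechanisms; lens-5 RootDecompCaptureCells — fate cells); lit search --hybrid "nonlinear
stability Kerr basin uniform extremal limit" ([corpus:arxiv-2302.06636 p.3],
[corpus:arxiv-2205.14808], Hintz2026 tree fact docstring pp. 318–319); lit search --hybrid "gluing
Kerr exterior arbitrary interior vacuum data event horizon gluing" ([corpus:arxiv-2402.10190 p.508
ref KU23], arXiv:2304.08455); lit galaxy search "close-limit|close limit
approximation|horizon-penetrating" --star all (textbook / review hits, no ladder-of-tubes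
decomposition); writer's N5/N2 searches (no population-split hit); ledger negatives --problem
FinalStateConjecture (no refuted statement is a cell-cure statement; refuted all-data upgrades not
restated).
Nearest prior art found: Hintz2026 Thm 13.1 / KlainermanSzeftel2023 Thm 1.2.1 (the germ of
PerturbativeCapture); ChristodoulouKlainerman1993 (germ of SmallDataDispersal); Kehle–Unger
arXiv:2304.08455 (populates the shell cells); in-tree ExactKerrEnds (`HasExactKerrEnd`, ρ̄ = ∞).
Delta: the data space of the typed summit is graded, exactly and for free, by explicit b-conormal
tubes around the model families windowed by spin collar and dressing depth, so that near-extremal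
capture and enclosed-core capture become separately typed S-implied cells between the p  [refs: 2304.08455, arxiv-2302.06636, arxiv-2205.14808, arxiv-2402.10190, Hintz2026, KlainermanSzeftel2023, ChristodoulouKlainerman1993]

Barriers (technique_class: population-split, Kerr-basin-ladder, b-conormal tubes): - technique_class: population-split, Kerr-basin-ladder, b-conormal tubes
- Literature.Barriers.FinalStateConjecture.AretakisInstability: bites NearExtremalCapture head-on
(no uniform-in-spin control up to |a| = M; transversal-derivative growth on extremal horizons) —
declared as that piece's BARRIER tag, not evaded; the bet is a dynamical third-law / no-overspinning
mechanism for perturbations large relative to the shrinking basin; the other four pieces stay at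
spin ≤ 9/10 or away from horizons.
- Literature.Barriers.FinalStateConjecture.AretakisInstabilityNarrow: same placement for the collar
cell; recorded.
- Literature.Barriers.FinalStateConjecture.SlowlyRotatingKerrFrontier: PerturbativeCapture at χ̄ =
9/10 lies beyond the refereed slowly-rotating range (KS 2023) and leans on the unrefereed full-range
claim (Hintz 2026) for its germ — acknowledged; the piece is not counted as content.
- Literature.Barriers.FinalStateConjecture.KerrStabilityHoldsBelowNarrow: the printed small-|a|
stability does NOT empty the perturbative cell at the typed β = 1 (ε inexplicit, absolute units) —
so PerturbativeCapture is not a restated theorem (critic T3), and it is tagged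
decorative-in-the-limit, not counted.
- Literature.Barriers.FinalStateConjecture.KerrSuperradiance: decay-estimate barrier for the linear
roads under the capture pieces; binders are data-side cure statements — outside; porting roads meet
it as the printed proofs do.
- Literature.Barriers.FinalStateConjecture.SbierskiTrappi

sub-problem: FinalStateConjecture · status: draft · opened planner-decomp-fsc-writer-1-g0-0 2026-08-30T02:20:33Z · rev 1 · ledger route-FinalStateConjecture-RootDecompKerrBasinLadder
GENERATED by the gate from the ledger (D-0016/17). Provers cite these decls: `theorem foo : Summit.FinalStateConjecture.FinalStateConjecture.Theses.RootDecompKerrBasinLadder.<Decl> := …` in Summits/FinalStateConjecture/FinalStateConjecture/Theorems/<Name>.lean.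
-/

namespace Summit.FinalStateConjecture.FinalStateConjecture.Theses.RootDecompKerrBasinLadder

open scoped BigOperators Topology Manifold Classical MeasureTheory ProbabilityTheory Matrix InnerProductSpace ComplexConjugate ContinuousMap
open Filter Set Function TopologicalSpace MeasureTheory

attribute [summit_statement] _root_.FinalStateConjecture

/-- item stmt-FinalStateConjecture-25089 · crux · rank 2 · open · by planner
why it might fail: no printed basin is uniform as χ → 1 and the extremal limit carries the Aretakis / zero-damped-mode instability; a near-extremal datum could overspin or hover at extremality along every tame curve through it.
sources: arXiv:1707.05862, arXiv:2211.15742, arXiv:1910.02854, Hintz2026, arXiv:1206.6598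
[crux] PIECE rung 1a — NearExtremalCapture at (s, δ, β, χ̄, ρ̄, β₀) = (6, −1, 1, 9/10, 3, 1)
[WEAKER·COUNTS — critic CLEARED[regime-fixed] 2026-08-30T01:33:24Z: «WEAKER·IDEA-NEEDED+BARRIER
(counts)»; leaf IDEA-NEEDED + BARRIER (AretakisInstability prices any uniform-ε approach) +
INSTRUMENTABLE (near-extremal QNM damping ∝ √(1−χ), degeneration rate of ε(χ))]. For every Σ and
every admissible P_Σ-exceptional datum d lying in the near-extremal Kerr window cell — granted the
vendored Kerr facts, some sub-extremal Kerr data (M, a, r₀) with 9/10 < |a|/M < 1 and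
horizon-penetrating depth 1 − √(1−χ²) < r₀/M < 1 + √(1−χ²), and a smooth cocompact open embedding θ
of the Kerr slice into Σ along which θ^*d is b-conormal (finite H^s'_(−1) distance at every order)
and 1-close at order 6 to the Kerr data — there are one end e and a tame immersed injective
one-parameter family F of admissible data with F 0 = d whose members c ≠ 0 satisfy P_Σ. [difficulty:
open-problem] -/
@[route_item "route-FinalStateConjecture-RootDecompKerrBasinLadder", crux]
def NearExtremalCapture : Prop :=
  ∀ (X : Type) [TopologicalSpace X] [ChartedSpace Literature.Geometry.Lorentzian.E3 X] [IsManifold (𝓡 3) ((⊤ : ℕ∞) : WithTop ℕ∞) X] [T2Space X] [SecondCountableTopology X] [ConnectedSpace X], let P : Literature.Geometry.Lorentzian.InitialDataSet (𝓡 3) X → Prop := fun D ↦ (∃ 𝒟 : Literature.Geometry.Lorentzian.VacuumCauchyDevelopment D, 𝒟.IsMaximal) ∧ ∀ 𝒟 : Literature.Geometry.Lorentzian.VacuumCauchyDevelopment D, 𝒟.IsMaximal → Summit.FinalStateConjecture.HasCompleteNullInfinity 𝒟.toCauchyDevelopment ∧ ∃ (O : Set 𝒟.carrier) (d : Literature.Geometry.Lorentzian.FinalStateDecomposition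 𝒟.toSpacetime O 2), (∀ i, Literature.Geometry.Lorentzian.Kerr.IsSubextremal (d.mass i) (d.spin i)) ∧ O = Summit.FinalStateConjecture.exteriorOf 𝒟.toCauchyDevelopment d.charted ∧ Summit.FinalStateConjecture.RaysStayInClosure 𝒟.toCauchyDevelopment O ∧ Summit.FinalStateConjecture.HasExhaustiveCharts d ∧ Summit.FinalStateConjecture.IsFutureOriented d; let K : Set (ℝ × ℝ) → Literature.Geometry.Lorentzian.InitialDataSet (𝓡 3) X → Prop := fun W D ↦ ∀ [Literature.Geometry.Lorentzian.Kerr.Facts] [Literature.Geometry.Lorentzian.Kerr.SliceFacts], ∃ (M a r₀ : ℝ) (hM : 0 < M), |a| < M ∧ (|a| / M, r₀ / M) ∈ W ∧ ∃ (θ : Literature.Geometry.Lorentzian.Kerr.slice a r₀ → X) (hθ : ContMDiff 𝓘(ℝ, Literature.Geometry.Lorentzian.E3) (𝓡 3) (((⊤ : ℕ∞) : WithTop ℕ∞) + 1) θ) (hθ' : ∀ u, Injective (mfderiv 𝓘(ℝ, Literature.Geometry.Lorentzian.E3) (𝓡 3) θ u)), Topology.IsOpenEmbedding θ ∧ IsCompact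 (range θ)ᶜ ∧ (∀ s' : ℕ, Literature.Geometry.Lorentzian.InitialDataSet.dataWeightedSobolevEDist s' (-1 : ℝ) (D.comap θ hθ hθ') (Literature.Geometry.Lorentzian.Kerr.data M a r₀ hM.le) < ⊤) ∧ Literature.Geometry.Lorentzian.InitialDataSet.dataWeightedSobolevEDist 6 (-1 : ℝ) (D.comap θ hθ hθ') (Literature.Geometry.Lorentzian.Kerr.data M a r₀ hM.le) < ENNReal.ofReal 1; let collar : Set (ℝ × ℝ) := {p | (9 / 10 : ℝ) < p.1 ∧ 1 - Real.sqrt (1 - p.1 ^ 2) < p.2 ∧ p.2 < 1 + Real.sqrt (1 - p.1 ^ 2)}; ∀ d ∈ Literature.Geometry.Lorentzian.admissibleVacuumData X, ¬ P d → K collar d → ∃ (e : Literature.Geometry.Lorentzian.AFEnd X) (F : EuclideanSpace ℝ (Fin 1) → Literature.Geometry.Lorentzian.InitialDataSet (𝓡 3) X), Literature.Geometry.Lorentzian.InitialDataSet.IsTameDataFamily e 1 F ∧ Literature.Geometry.Lorentzian.InitialDataSet.IsImmersedAtZero 1 F ∧ F 0 = d ∧ Injective F ∧ (∀ c, F c ∈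 Literature.Geometry.Lorentzian.admissibleVacuumData X) ∧ ∀ c ≠ 0, P (F c)

/-- item stmt-FinalStateConjecture-25090 · crux · rank 3 · open · by planner
why it might fail: a strong-field core inside r ≤ 3M (near-critical packet inside its own hoop, pre-merger binary) may form a naked singularity or a non-settling exterior robustly along tame curves — no theorem controls any core below the dressing sphere.
sources: arXiv:2304.08455, arXiv:gr-qc/9402039, arXiv:0805.3880, CorvinoSchoen2006
[crux] PIECE rung 1b — EnclosedCoreCapture at (s, δ, β, χ̄, ρ̄, β₀) = (6, −1, 1, 9/10, 3, 1)
[WEAKER·COUNTS — critic: «WEAKER·IDEA-NEEDED·INSTRUMENTABLE (counts; COSTUME only as ρ̄ → ∞)»; leaf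
INSTRUMENTABLE (close-limit / NR at ρ̄ = 3) + IDEA-NEEDED (large-data mechanism confined to a
compact core: trapped-surface formation inside the hoop, then rung 0)]. For every Σ and every
admissible P_Σ-exceptional datum d lying in the enclosed-core shell cell — sub-extremal Kerr
dressing (b-conormal, 1-close at order 6, weight −1) along a cocompact embedded Kerr slice that
reaches only down to a sphere r₀ = ρM with 1 + √(1−χ²) ≤ ρ ≤ 3 (on or outside the horizon radius;
the core inside is arbitrary) — there are one end e and a tame immersed injective admissible
one-parameter family F with F 0 = d whose members c ≠ 0 satisfy P_Σ. [difficulty: open-problem] -/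
@[route_item "route-FinalStateConjecture-RootDecompKerrBasinLadder", crux]
def EnclosedCoreCapture : Prop :=
  ∀ (X : Type) [TopologicalSpace X] [ChartedSpace Literature.Geometry.Lorentzian.E3 X] [IsManifold (𝓡 3) ((⊤ : ℕ∞) : WithTop ℕ∞) X] [T2Space X] [SecondCountableTopology X] [ConnectedSpace X], let P : Literature.Geometry.Lorentzian.InitialDataSet (𝓡 3) X → Prop := fun D ↦ (∃ 𝒟 : Literature.Geometry.Lorentzian.VacuumCauchyDevelopment D, 𝒟.IsMaximal) ∧ ∀ 𝒟 : Literature.Geometry.Lorentzian.VacuumCauchyDevelopment D, 𝒟.IsMaximal → Summit.FinalStateConjecture.HasCompleteNullInfinity 𝒟.toCauchyDevelopment ∧ ∃ (O : Set 𝒟.carrier) (d : Literature.Geometry.Lorentzian.FinalStateDecomposition 𝒟.toSpacetime O 2), (∀ i, Literature.Geometry.Lorentzian.Kerr.IsSubextremal (d.mass i) (d.spin i)) ∧ O = Summit.FinalStateConjecture.exteriorOf 𝒟.toCauchyDevelopment d.charted ∧ Summit.FinalStateConjecture.RaysStayInClosure 𝒟.toCauchyDevelopment O ∧ Summit.FinalStateConjecture.HasExhaustiveCharts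 d ∧ Summit.FinalStateConjecture.IsFutureOriented d; let K : Set (ℝ × ℝ) → Literature.Geometry.Lorentzian.InitialDataSet (𝓡 3) X → Prop := fun W D ↦ ∀ [Literature.Geometry.Lorentzian.Kerr.Facts] [Literature.Geometry.Lorentzian.Kerr.SliceFacts], ∃ (M a r₀ : ℝ) (hM : 0 < M), |a| < M ∧ (|a| / M, r₀ / M) ∈ W ∧ ∃ (θ : Literature.Geometry.Lorentzian.Kerr.slice a r₀ → X) (hθ : ContMDiff 𝓘(ℝ, Literature.Geometry.Lorentzian.E3) (𝓡 3) (((⊤ : ℕ∞) : WithTop ℕ∞) + 1) θ) (hθ' : ∀ u, Injective (mfderiv 𝓘(ℝ, Literature.Geometry.Lorentzian.E3) (𝓡 3) θ u)), Topology.IsOpenEmbedding θ ∧ IsCompact (range θ)ᶜ ∧ (∀ s' : ℕ, Literature.Geometry.Lorentzian.InitialDataSet.dataWeightedSobolevEDist s' (-1 : ℝ) (D.comap θ hθ hθ') (Literature.Geometry.Lorentzian.Kerr.data M a r₀ hM.le) < ⊤) ∧ Literature.Geometry.Lorentzian.InitialDataSet.dataWeightedSobolevEDist 6 (-1 : ℝ)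 (D.comap θ hθ hθ') (Literature.Geometry.Lorentzian.Kerr.data M a r₀ hM.le) < ENNReal.ofReal 1; let shell : Set (ℝ × ℝ) := {p | 1 + Real.sqrt (1 - p.1 ^ 2) ≤ p.2 ∧ p.2 ≤ 3}; ∀ d ∈ Literature.Geometry.Lorentzian.admissibleVacuumData X, ¬ P d → K shell d → ∃ (e : Literature.Geometry.Lorentzian.AFEnd X) (F : EuclideanSpace ℝ (Fin 1) → Literature.Geometry.Lorentzian.InitialDataSet (𝓡 3) X), Literature.Geometry.Lorentzian.InitialDataSet.IsTameDataFamily e 1 F ∧ Literature.Geometry.Lorentzian.InitialDataSet.IsImmersedAtZero 1 F ∧ F 0 = d ∧ Injective F ∧ (∀ c, F c ∈ Literature.Geometry.Lorentzian.admissibleVacuumData X) ∧ ∀ c ≠ 0, P (F c)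

/-- item stmt-FinalStateConjecture-25091 · crux · rank 4 · SPLIT (gen 1) into HorizonDominatedResidual, SubPenroseResidual + glue ExtendedFieldResidualGlue · direct attempts still welcome (low priority) · by planner
why it might fail: this is weak cosmic censorship plus final-state settling for genuinely extended large data (N ≥ 2 receding configurations, extended incoming radiation): a robust naked singularity or eternal non-settling dynamics far from every model tube kills it.
sources: DafermosLuk2017, Christodoulou1999, CorvinoSchoen2006, arXiv:gr-qc/0702084
[crux] PIECE residual — ExtendedFieldResidual at (s, δ, β, χ̄, ρ̄, β₀) = (6, −1, 1, 9/10, 3, 1)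
[WEAKER·RESIDUAL near-wholesale — critic: «RESIDUAL near-wholesale (17269/17308)»; INTERNAL NODE for
gen ≥ 1 (multi-centre data, extended incoming radiation, rough tails; rough-tail sub-leaf ATTACKABLE
by gluing along tame curves, cf. route ExactKerrEnds item TameEscapeToKerrEnds)]. For every Σ and
every admissible P_Σ-exceptional datum d in NO model cell — not in the perturbative, collar or shell
Kerr window cells at β = 1 and not in the Minkowski cell at β₀ = 1 — there are one end e and a tame
immersed injective admissible one-parameter family F with F 0 = d whose members c ≠ 0 satisfy P_Σ.
[difficulty: open-problem] -/
@[route_item "route-FinalStateConjecture-RootDecompKerrBasinLadder", crux]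
def ExtendedFieldResidual : Prop :=
  ∀ (X : Type) [TopologicalSpace X] [ChartedSpace Literature.Geometry.Lorentzian.E3 X] [IsManifold (𝓡 3) ((⊤ : ℕ∞) : WithTop ℕ∞) X] [T2Space X] [SecondCountableTopology X] [ConnectedSpace X], let P : Literature.Geometry.Lorentzian.InitialDataSet (𝓡 3) X → Prop := fun D ↦ (∃ 𝒟 : Literature.Geometry.Lorentzian.VacuumCauchyDevelopment D, 𝒟.IsMaximal) ∧ ∀ 𝒟 : Literature.Geometry.Lorentzian.VacuumCauchyDevelopment D, 𝒟.IsMaximal → Summit.FinalStateConjecture.HasCompleteNullInfinity 𝒟.toCauchyDevelopment ∧ ∃ (O : Set 𝒟.carrier) (d : Literature.Geometry.Lorentzian.FinalStateDecomposition 𝒟.toSpacetime O 2), (∀ i, Literature.Geometry.Lorentzian.Kerr.IsSubextremal (d.mass i) (d.spin i)) ∧ O = Summit.FinalStateConjecture.exteriorOf 𝒟.toCauchyDevelopment d.charted ∧ Summit.FinalStateConjecture.RaysStayInClosure 𝒟.toCauchyDevelopment O ∧ Summit.FinalStateConjecture.HasExhaustiveCharts d ∧ Summit.FinalStateConjecture.IsFutureOriented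 d; let K : Set (ℝ × ℝ) → Literature.Geometry.Lorentzian.InitialDataSet (𝓡 3) X → Prop := fun W D ↦ ∀ [Literature.Geometry.Lorentzian.Kerr.Facts] [Literature.Geometry.Lorentzian.Kerr.SliceFacts], ∃ (M a r₀ : ℝ) (hM : 0 < M), |a| < M ∧ (|a| / M, r₀ / M) ∈ W ∧ ∃ (θ : Literature.Geometry.Lorentzian.Kerr.slice a r₀ → X) (hθ : ContMDiff 𝓘(ℝ, Literature.Geometry.Lorentzian.E3) (𝓡 3) (((⊤ : ℕ∞) : WithTop ℕ∞) + 1) θ) (hθ' : ∀ u, Injective (mfderiv 𝓘(ℝ, Literature.Geometry.Lorentzian.E3) (𝓡 3) θ u)), Topology.IsOpenEmbedding θ ∧ IsCompact (range θ)ᶜ ∧ (∀ s' : ℕ, Literature.Geometry.Lorentzian.InitialDataSet.dataWeightedSobolevEDist s' (-1 : ℝ) (D.comap θ hθ hθ') (Literature.Geometry.Lorentzian.Kerr.data M a r₀ hM.le) < ⊤) ∧ Literature.Geometry.Lorentzian.InitialDataSet.dataWeightedSobolevEDist 6 (-1 : ℝ) (D.comap θ hθ hθ') (Literature.Geometry.Lorentzian.Kerr.data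 M a r₀ hM.le) < ENNReal.ofReal 1; let Mink : Literature.Geometry.Lorentzian.InitialDataSet (𝓡 3) X → Prop := fun D ↦ ∃ (θ : Literature.Geometry.Lorentzian.Minkowski.slice → X) (hθ : ContMDiff 𝓘(ℝ, Literature.Geometry.Lorentzian.E3) (𝓡 3) (((⊤ : ℕ∞) : WithTop ℕ∞) + 1) θ) (hθ' : ∀ u, Injective (mfderiv 𝓘(ℝ, Literature.Geometry.Lorentzian.E3) (𝓡 3) θ u)), Topology.IsOpenEmbedding θ ∧ Surjective θ ∧ (∀ s' : ℕ, Literature.Geometry.Lorentzian.InitialDataSet.dataWeightedSobolevEDist s' (-1 : ℝ) (D.comap θ hθ hθ') Literature.Geometry.Lorentzian.trivialData < ⊤) ∧ Literature.Geometry.Lorentzian.InitialDataSet.dataWeightedSobolevEDist 6 (-1 : ℝ) (D.comap θ hθ hθ') Literature.Geometry.Lorentzian.trivialData < ENNReal.ofReal 1; let pert : Set (ℝ × ℝ) := {p | p.1 ≤ (9 / 10 : ℝ) ∧ 1 - Real.sqrt (1 - p.1 ^ 2) < p.2 ∧ p.2 < 1 + Real.sqrt (1 - p.1 ^ 2)};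 let collar : Set (ℝ × ℝ) := {p | (9 / 10 : ℝ) < p.1 ∧ 1 - Real.sqrt (1 - p.1 ^ 2) < p.2 ∧ p.2 < 1 + Real.sqrt (1 - p.1 ^ 2)}; let shell : Set (ℝ × ℝ) := {p | 1 + Real.sqrt (1 - p.1 ^ 2) ≤ p.2 ∧ p.2 ≤ 3}; ∀ d ∈ Literature.Geometry.Lorentzian.admissibleVacuumData X, ¬ P d → (¬ K pert d ∧ ¬ K collar d ∧ ¬ K shell d ∧ ¬ Mink d) → ∃ (e : Literature.Geometry.Lorentzian.AFEnd X) (F : EuclideanSpace ℝ (Fin 1) → Literature.Geometry.Lorentzian.InitialDataSet (𝓡 3) X), Literature.Geometry.Lorentzian.InitialDataSet.IsTameDataFamily e 1 F ∧ Literature.Geometry.Lorentzian.InitialDataSet.IsImmersedAtZero 1 F ∧ F 0 = d ∧ Injective F ∧ (∀ c, F c ∈ Literature.Geometry.Lorentzian.admissibleVacuumData X) ∧ ∀ c ≠ 0, P (F c)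

-- parent: ExtendedFieldResidual · child (gen 1)
/--     item stmt-FinalStateConjecture-26560 · crux · rank 401 · open
    parent: ExtendedFieldResidual · by planner
    why it might fail: Near-saturating apparent horizons do not control the exterior in the H^s norms Kerr stability consumes (Lee–Sormani, Allen, Dong: weak norms only); a laminated capture threshold inside 𝓗(9/10) (comparable spectators just under the 10 % budget) would defeat tame exits.
    sources: arXiv:1109.2165, arXiv:1705.00591, doi:10.2140/gt.2025.29.4911, arXiv:2304.08455, Christodoulou1999
[crux · gen-2 glued split of ExtendedFieldResidual (stmt-25091), lens-1 g2 node HorizonSplit,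
CLEARED[+follow-ups F1–F3] by decomp-fsc-crit-1-g0 2026-08-30T02:58:30Z; child A = S-exit on R ∩
𝓗(9/10): the residual data (unit-far from every model tube of the born tuple (6,−1,1,9/10,3,1))
whose slice carries an outermost MOTS S bounding the sole end's exterior, WOT-free outside, m_ADM >
0 and ENCLOSURE Penrose ratio √(A_min(S)/16π) ≥ (9/10)·m_ADM; RESIDUAL-relieved · WEAKER (kernel
horizonDominatedResidualAt_of_summit, split_iff; probes A → S / A → parent fail) · COUNTS-candidate
→ COUNTS once F1 (kernel Hor_core_iff_of_admissible on admissible data) lands (critic 03:16:15Z: F2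
inhabitant SATISFIED at print level — late slices of one-ended collapse radiating < 19 %; F3: the p̄
= 1, k = 0 stratum is DECORATIVE-true either way and is NOT a rung of this piece) ·
IDEA-NEEDED[U_rate] (caution c4 F8 topology mismatch applies to any porting reading) (no theorem
evolves large vacuum data containing a MOTS to a settled exterior; near-equality Penrose rigidity
controls the exterior only weakly) · INSTRUMENTABLE (census T-H1–T-H3); ceiling p̄ > 1 EMPTY under
the corrected enclosure Penrose inequ -/
@[route_item "route-FinalStateConjecture-RootDecompKerrBasinLadder"]
def HorizonDominatedResidual : Prop :=
  ∀ (X : Type) [TopologicalSpace X] [ChartedSpace Literature.Geometry.Lorentzian.E3 X] [IsManifold (𝓡 3) ((⊤ : ℕ∞) : WithTop ℕ∞) X] [T2Space X] [SecondCountableTopology X] [ConnectedSpace X], let P : Literature.Geometry.Lorentzian.InitialDataSet (𝓡 3) X → Prop := fun D ↦ (∃ 𝒟 : Literature.Geometry.Lorentzian.VacuumCauchyDevelopment D, 𝒟.IsMaximal) ∧ ∀ 𝒟 : Literature.Geometry.Lorentzian.VacuumCauchyDevelopment D, 𝒟.IsMaximal → Summit.FinalStateConjecture.HasCompleteNullInfinity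 𝒟.toCauchyDevelopment ∧ ∃ (O : Set 𝒟.carrier) (d : Literature.Geometry.Lorentzian.FinalStateDecomposition 𝒟.toSpacetime O 2), (∀ i, Literature.Geometry.Lorentzian.Kerr.IsSubextremal (d.mass i) (d.spin i)) ∧ O = Summit.FinalStateConjecture.exteriorOf 𝒟.toCauchyDevelopment d.charted ∧ Summit.FinalStateConjecture.RaysStayInClosure 𝒟.toCauchyDevelopment O ∧ Summit.FinalStateConjecture.HasExhaustiveCharts d ∧ Summit.FinalStateConjecture.IsFutureOriented d; let K : Set (ℝ × ℝ) → Literature.Geometry.Lorentzian.InitialDataSet (𝓡 3) X → Prop := fun W D ↦ ∀ [Literature.Geometry.Lorentzian.Kerr.Facts] [Literature.Geometry.Lorentzian.Kerr.SliceFacts], ∃ (M a r₀ : ℝ) (hM : 0 < M), |a| < M ∧ (|a| / M, r₀ / M) ∈ W ∧ ∃ (θ : Literature.Geometry.Lorentzian.Kerr.slice a r₀ → X) (hθ : ContMDiff 𝓘(ℝ, Literature.Geometry.Lorentzian.E3) (𝓡 3) (((⊤ : ℕ∞) : WithTop ℕ∞) + 1) θ) (hθ' : ∀ u, Injective (mfderiv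 𝓘(ℝ, Literature.Geometry.Lorentzian.E3) (𝓡 3) θ u)), Topology.IsOpenEmbedding θ ∧ IsCompact (range θ)ᶜ ∧ (∀ s' : ℕ, Literature.Geometry.Lorentzian.InitialDataSet.dataWeightedSobolevEDist s' (-1 : ℝ) (D.comap θ hθ hθ') (Literature.Geometry.Lorentzian.Kerr.data M a r₀ hM.le) < ⊤) ∧ Literature.Geometry.Lorentzian.InitialDataSet.dataWeightedSobolevEDist 6 (-1 : ℝ) (D.comap θ hθ hθ') (Literature.Geometry.Lorentzian.Kerr.data M a r₀ hM.le) < ENNReal.ofReal 1; let Mink : Literature.Geometry.Lorentzian.InitialDataSet (𝓡 3) X → Prop := fun D ↦ ∃ (θ : Literature.Geometry.Lorentzian.Minkowski.slice → X) (hθ : ContMDiff 𝓘(ℝ, Literature.Geometry.Lorentzian.E3) (𝓡 3) (((⊤ : ℕ∞) : WithTop ℕ∞) + 1) θ) (hθ' : ∀ u, Injective (mfderiv 𝓘(ℝ, Literature.Geometry.Lorentzian.E3) (𝓡 3) θ u)), Topology.IsOpenEmbedding θ ∧ Surjective θ ∧ (∀ s' : ℕ, Literature.Geometry.Lorentzian.InitialDataSet.dataWeightedSobolevEDist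 s' (-1 : ℝ) (D.comap θ hθ hθ') Literature.Geometry.Lorentzian.trivialData < ⊤) ∧ Literature.Geometry.Lorentzian.InitialDataSet.dataWeightedSobolevEDist 6 (-1 : ℝ) (D.comap θ hθ hθ') Literature.Geometry.Lorentzian.trivialData < ENNReal.ofReal 1; let pert : Set (ℝ × ℝ) := {p | p.1 ≤ (9 / 10 : ℝ) ∧ 1 - Real.sqrt (1 - p.1 ^ 2) < p.2 ∧ p.2 < 1 + Real.sqrt (1 - p.1 ^ 2)}; let collar : Set (ℝ × ℝ) := {p | (9 / 10 : ℝ) < p.1 ∧ 1 - Real.sqrt (1 - p.1 ^ 2) < p.2 ∧ p.2 < 1 + Real.sqrt (1 - p.1 ^ 2)}; let shell : Set (ℝ × ℝ) := {p | 1 + Real.sqrt (1 - p.1 ^ 2) ≤ p.2 ∧ p.2 ≤ 3}; let Hor : Literature.Geometry.Lorentzian.InitialDataSet (𝓡 3) X → Prop := fun D ↦ ∃ (hLC : D.metric.HasLeviCivita) (e : Literature.Geometry.Lorentzian.AFEnd X) (S : Literature.Geometry.Lorentzian.OutermostMOTS (𝓡 3) D.h D.k), haveI : (Literature.Geometry.Lorentzian.PseudoRiemannianMetric.ofRiemannian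 D.h).HasLeviCivita := hLC; let IsExteriorRegion : TopologicalSpace.Opens X → Prop := fun U ↦ IsConnected (U : Set X) ∧ ∃ R', e.R < R' ∧ e.far R' ⊆ (U : Set X) ∧ IsCompact (closure (U : Set X) \ e.far R'); let IsOutsideOf : TopologicalSpace.Opens X → (S' : Type) → (f' : S' → X) → Literature.Geometry.Lorentzian.NormalField (𝓡 3) f' → Prop := fun U _ f' ν' ↦ frontier (U : Set X) = Set.range f' ∧ (∀ y, ∀ᶠ t in nhdsWithin (0 : ℝ) (Set.Ioi 0), Literature.Geometry.Lorentzian.curveThrough (𝓡 3) (f' y) (ν' y) t ∈ (U : Set X)) ∧ (∀ y, ∀ᶠ t in nhdsWithin (0 : ℝ) (Set.Iio 0), Literature.Geometry.Lorentzian.curveThrough (𝓡 3) (f' y) (ν' y) t ∉ closure (U : Set X)) ∧ IsExteriorRegion U; let IsCalS : TopologicalSpace.Opens X → Prop := fun V ↦ ∃ (S' : Type) (_ : TopologicalSpace S') (_ : ChartedSpace (EuclideanSpace ℝ (Fin 2)) S') (_ : IsManifold (𝓡 2) ((⊤ : ℕ∞) : WithTop ℕ∞) S') (_ : CompactSpace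 S') (_ : T2Space S') (f' : S' → X) (ν' : Literature.Geometry.Lorentzian.NormalField (𝓡 3) f'), Manifold.IsSmoothEmbedding (𝓡 2) (𝓡 3) ((⊤ : ℕ∞) : WithTop ℕ∞) f' ∧ (Literature.Geometry.Lorentzian.PseudoRiemannianMetric.ofRiemannian D.h).IsUnitNormal (𝓡 2) f' ν' 1 ∧ IsOutsideOf V S' f' ν'; let WOTFree : TopologicalSpace.Opens X → Prop := fun U ↦ ∀ (S' : Type) [TopologicalSpace S'] [ChartedSpace (EuclideanSpace ℝ (Fin 2)) S'] [IsManifold (𝓡 2) ((⊤ : ℕ∞) : WithTop ℕ∞) S'] [CompactSpace S'] [T2Space S'] (f' : S' → X) (ν' : Literature.Geometry.Lorentzian.NormalField (𝓡 3) f') (hpb' : Literature.Geometry.Lorentzian.PseudoRiemannianMetric.contMDiff_pullbackBilin (𝓡 3) X (𝓡 2) S' ((⊤ : ℕ∞) : WithTop ℕ∞)) (hf' : (Literature.Geometry.Lorentzian.PseudoRiemannianMetric.ofRiemannian D.h).IsSpacelikeImmersion (𝓡 2) f') (Ω : TopologicalSpace.Opens X), Manifold.IsSmoothEmbedding (𝓡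 2) (𝓡 3) ((⊤ : ℕ∞) : WithTop ℕ∞) f' → Set.range f' ⊆ (U : Set X) → (Literature.Geometry.Lorentzian.PseudoRiemannianMetric.ofRiemannian D.h).IsUnitNormal (𝓡 2) f' ν' 1 → Nonempty S' → frontier (Ω : Set X) = Set.range f' → (∃ R', e.R < R' ∧ Disjoint (e.far R') (Ω : Set X)) → (∀ y, ∀ᶠ t in nhdsWithin (0 : ℝ) (Set.Iio 0), Literature.Geometry.Lorentzian.curveThrough (𝓡 3) (f' y) (ν' y) t ∈ (Ω : Set X)) → ¬ Literature.Geometry.Lorentzian.IsWeaklyOuterTrapped D.h D.k f' hpb' hf' ν'; ContMDiff (𝓡 2) (𝓡 3).tangent ((⊤ : ℕ∞) : WithTop ℕ∞) (fun y ↦ (Bundle.TotalSpace.mk' Literature.Geometry.Lorentzian.E3 (S.f y) (S.ν y) : TangentBundle (𝓡 3) X)) ∧ D.SatisfiesDominantEnergyCondition ∧ e.IsAsymptoticallyFlat D 1 ∧ D.IsComplete ∧ (∃ m, e.HasADMEnergy D m) ∧ (∀ i, ∃ p, e.HasADMMomentum D i p) ∧ WOTFree S.exterior ∧ IsOutsideOf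 S.exterior S.surf S.f S.ν ∧ 0 < e.admMass D ∧ (letI : MeasurableSpace X := borel X; haveI : BorelSpace X := ⟨rfl⟩; haveI : LocallyCompactSpace X := ChartedSpace.locallyCompactSpace Literature.Geometry.Lorentzian.E3 X; (9 / 10 : ℝ) * e.admMass D ≤ Real.sqrt ((⨅ (V : TopologicalSpace.Opens X) (_ : IsCalS V ∧ V ≤ S.exterior), Literature.Geometry.Lorentzian.area D.h (frontier (V : Set X))).toReal / (16 * Real.pi))); ∀ d ∈ Literature.Geometry.Lorentzian.admissibleVacuumData X, ¬ P d → (¬ K pert d ∧ ¬ K collar d ∧ ¬ K shell d ∧ ¬ Mink d) → Hor d → ∃ (e : Literature.Geometry.Lorentzian.AFEnd X) (F : EuclideanSpace ℝ (Fin 1) → Literature.Geometry.Lorentzian.InitialDataSet (𝓡 3) X), Literature.Geometry.Lorentzian.InitialDataSet.IsTameDataFamily e 1 F ∧ Literature.Geometry.Lorentzian.InitialDataSet.IsImmersedAtZero 1 F ∧ F 0 = d ∧ Injective F ∧ (∀ c, F c ∈ Literature.Geometry.Lorentzian.admissibleVacuumData X) ∧ ∀ c ≠ 0, P (F c)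

-- parent: ExtendedFieldResidual · child (gen 1)
/--     item stmt-FinalStateConjecture-26561 · crux · rank 402 · open
    parent: ExtendedFieldResidual · by planner
    why it might fail: This is large-data weak cosmic censorship plus generic settling with no horizon on the slice: a tame-codimension-0 set of naked-singularity or eternal few-body data anywhere below the Penrose ratio 9/10 refutes it (and S).
    sources: Christodoulou1999, arXiv:gr-qc/9910040, arXiv:1310.4209
[crux · gen-2 glued split of ExtendedFieldResidual (stmt-25091), lens-1 g2 node HorizonSplit,
CLEARED 2026-08-30T02:58:30Z; child B = S-exit on R ∖ 𝓗(9/10): residual data whose slice carries NO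
near-saturating apparent horizon — comparable-mass multi-centre data (p ≲ 0.71), collapsing data not
yet trapped on the slice (large-data collapse threshold = weak cosmic censorship), extended incoming
radiation, rough tails; WEAKER (kernel subPenroseResidualAt_of_summit; probes fail) · the NEW
RESIDUAL, strictly weaker than the parent exactly by the open rung A · INTERNAL NODE gen ≥ 3 ·
carries the hard cores stmt-17269 / stmt-17308 outside the model tubes; glue A → B → parent proved
(writer folder/n1g2/Sketch.lean extendedFieldResidual_of_split + split_iff, rc 0 / 0 sorry; lens
HorizonSplit.glue); A_min vocabulary (IsExteriorRegion / IsWeaklyOuterTrappedFree / IsOutsideOf /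
IsCalS / minimalEnclosureArea) inlined as nested lets = VERBATIM transcription of the AFEnd.* defs
of Literature/Geometry/Lorentzian/EnclosureArea.lean (sha256/16 846bb3229da98cb0, Aug 15) because
that module has NO olean on the farm (remote:stale:16:unbuilt, writer 03:01Z/03:05Z); critic
must-fix «import + AFEnd.* name -/
@[route_item "route-FinalStateConjecture-RootDecompKerrBasinLadder"]
def SubPenroseResidual : Prop :=
  ∀ (X : Type) [TopologicalSpace X] [ChartedSpace Literature.Geometry.Lorentzian.E3 X] [IsManifold (𝓡 3) ((⊤ : ℕ∞) : WithTop ℕ∞) X] [T2Space X] [SecondCountableTopology X] [ConnectedSpace X], let P : Literature.Geometry.Lorentzian.InitialDataSet (𝓡 3) X → Prop := fun D ↦ (∃ 𝒟 : Literature.Geometry.Lorentzian.VacuumCauchyDevelopment D, 𝒟.IsMaximal) ∧ ∀ 𝒟 : Literature.Geometry.Lorentzian.VacuumCauchyDevelopment D, 𝒟.IsMaximal → Summit.FinalStateConjecture.HasCompleteNullInfinity 𝒟.toCauchyDevelopment ∧ ∃ (O : Set 𝒟.carrier) (d : Literature.Geometry.Lorentzian.FinalStateDecomposition 𝒟.toSpacetime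 O 2), (∀ i, Literature.Geometry.Lorentzian.Kerr.IsSubextremal (d.mass i) (d.spin i)) ∧ O = Summit.FinalStateConjecture.exteriorOf 𝒟.toCauchyDevelopment d.charted ∧ Summit.FinalStateConjecture.RaysStayInClosure 𝒟.toCauchyDevelopment O ∧ Summit.FinalStateConjecture.HasExhaustiveCharts d ∧ Summit.FinalStateConjecture.IsFutureOriented d; let K : Set (ℝ × ℝ) → Literature.Geometry.Lorentzian.InitialDataSet (𝓡 3) X → Prop := fun W D ↦ ∀ [Literature.Geometry.Lorentzian.Kerr.Facts] [Literature.Geometry.Lorentzian.Kerr.SliceFacts], ∃ (M a r₀ : ℝ) (hM : 0 < M), |a| < M ∧ (|a| / M, r₀ / M) ∈ W ∧ ∃ (θ : Literature.Geometry.Lorentzian.Kerr.slice a r₀ → X) (hθ : ContMDiff 𝓘(ℝ, Literature.Geometry.Lorentzian.E3) (𝓡 3) (((⊤ : ℕ∞) : WithTop ℕ∞) + 1) θ) (hθ' : ∀ u, Injective (mfderiv 𝓘(ℝ, Literature.Geometry.Lorentzian.E3) (𝓡 3) θ u)), Topology.IsOpenEmbedding θ ∧ IsCompact (range θ)ᶜ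 ∧ (∀ s' : ℕ, Literature.Geometry.Lorentzian.InitialDataSet.dataWeightedSobolevEDist s' (-1 : ℝ) (D.comap θ hθ hθ') (Literature.Geometry.Lorentzian.Kerr.data M a r₀ hM.le) < ⊤) ∧ Literature.Geometry.Lorentzian.InitialDataSet.dataWeightedSobolevEDist 6 (-1 : ℝ) (D.comap θ hθ hθ') (Literature.Geometry.Lorentzian.Kerr.data M a r₀ hM.le) < ENNReal.ofReal 1; let Mink : Literature.Geometry.Lorentzian.InitialDataSet (𝓡 3) X → Prop := fun D ↦ ∃ (θ : Literature.Geometry.Lorentzian.Minkowski.slice → X) (hθ : ContMDiff 𝓘(ℝ, Literature.Geometry.Lorentzian.E3) (𝓡 3) (((⊤ : ℕ∞) : WithTop ℕ∞) + 1) θ) (hθ' : ∀ u, Injective (mfderiv 𝓘(ℝ, Literature.Geometry.Lorentzian.E3) (𝓡 3) θ u)), Topology.IsOpenEmbedding θ ∧ Surjective θ ∧ (∀ s' : ℕ, Literature.Geometry.Lorentzian.InitialDataSet.dataWeightedSobolevEDist s' (-1 : ℝ) (D.comap θ hθ hθ') Literature.Geometry.Lorentzian.trivialData < ⊤) ∧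 Literature.Geometry.Lorentzian.InitialDataSet.dataWeightedSobolevEDist 6 (-1 : ℝ) (D.comap θ hθ hθ') Literature.Geometry.Lorentzian.trivialData < ENNReal.ofReal 1; let pert : Set (ℝ × ℝ) := {p | p.1 ≤ (9 / 10 : ℝ) ∧ 1 - Real.sqrt (1 - p.1 ^ 2) < p.2 ∧ p.2 < 1 + Real.sqrt (1 - p.1 ^ 2)}; let collar : Set (ℝ × ℝ) := {p | (9 / 10 : ℝ) < p.1 ∧ 1 - Real.sqrt (1 - p.1 ^ 2) < p.2 ∧ p.2 < 1 + Real.sqrt (1 - p.1 ^ 2)}; let shell : Set (ℝ × ℝ) := {p | 1 + Real.sqrt (1 - p.1 ^ 2) ≤ p.2 ∧ p.2 ≤ 3}; let Hor : Literature.Geometry.Lorentzian.InitialDataSet (𝓡 3) X → Prop := fun D ↦ ∃ (hLC : D.metric.HasLeviCivita) (e : Literature.Geometry.Lorentzian.AFEnd X) (S : Literature.Geometry.Lorentzian.OutermostMOTS (𝓡 3) D.h D.k), haveI : (Literature.Geometry.Lorentzian.PseudoRiemannianMetric.ofRiemannian D.h).HasLeviCivita := hLC; let IsExteriorRegion : TopologicalSpace.Opens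 X → Prop := fun U ↦ IsConnected (U : Set X) ∧ ∃ R', e.R < R' ∧ e.far R' ⊆ (U : Set X) ∧ IsCompact (closure (U : Set X) \ e.far R'); let IsOutsideOf : TopologicalSpace.Opens X → (S' : Type) → (f' : S' → X) → Literature.Geometry.Lorentzian.NormalField (𝓡 3) f' → Prop := fun U _ f' ν' ↦ frontier (U : Set X) = Set.range f' ∧ (∀ y, ∀ᶠ t in nhdsWithin (0 : ℝ) (Set.Ioi 0), Literature.Geometry.Lorentzian.curveThrough (𝓡 3) (f' y) (ν' y) t ∈ (U : Set X)) ∧ (∀ y, ∀ᶠ t in nhdsWithin (0 : ℝ) (Set.Iio 0), Literature.Geometry.Lorentzian.curveThrough (𝓡 3) (f' y) (ν' y) t ∉ closure (U : Set X)) ∧ IsExteriorRegion U; let IsCalS : TopologicalSpace.Opens X → Prop := fun V ↦ ∃ (S' : Type) (_ : TopologicalSpace S') (_ : ChartedSpace (EuclideanSpace ℝ (Fin 2)) S') (_ : IsManifold (𝓡 2) ((⊤ : ℕ∞) : WithTop ℕ∞) S') (_ : CompactSpace S') (_ : T2Space S') (f' : S' → X) (ν' : Literature.Geometry.Lorentzian.NormalField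 (𝓡 3) f'), Manifold.IsSmoothEmbedding (𝓡 2) (𝓡 3) ((⊤ : ℕ∞) : WithTop ℕ∞) f' ∧ (Literature.Geometry.Lorentzian.PseudoRiemannianMetric.ofRiemannian D.h).IsUnitNormal (𝓡 2) f' ν' 1 ∧ IsOutsideOf V S' f' ν'; let WOTFree : TopologicalSpace.Opens X → Prop := fun U ↦ ∀ (S' : Type) [TopologicalSpace S'] [ChartedSpace (EuclideanSpace ℝ (Fin 2)) S'] [IsManifold (𝓡 2) ((⊤ : ℕ∞) : WithTop ℕ∞) S'] [CompactSpace S'] [T2Space S'] (f' : S' → X) (ν' : Literature.Geometry.Lorentzian.NormalField (𝓡 3) f') (hpb' : Literature.Geometry.Lorentzian.PseudoRiemannianMetric.contMDiff_pullbackBilin (𝓡 3) X (𝓡 2) S' ((⊤ : ℕ∞) : WithTop ℕ∞)) (hf' : (Literature.Geometry.Lorentzian.PseudoRiemannianMetric.ofRiemannian D.h).IsSpacelikeImmersion (𝓡 2) f') (Ω : TopologicalSpace.Opens X), Manifold.IsSmoothEmbedding (𝓡 2) (𝓡 3) ((⊤ : ℕ∞) : WithTop ℕ∞) f' → Set.range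 f' ⊆ (U : Set X) → (Literature.Geometry.Lorentzian.PseudoRiemannianMetric.ofRiemannian D.h).IsUnitNormal (𝓡 2) f' ν' 1 → Nonempty S' → frontier (Ω : Set X) = Set.range f' → (∃ R', e.R < R' ∧ Disjoint (e.far R') (Ω : Set X)) → (∀ y, ∀ᶠ t in nhdsWithin (0 : ℝ) (Set.Iio 0), Literature.Geometry.Lorentzian.curveThrough (𝓡 3) (f' y) (ν' y) t ∈ (Ω : Set X)) → ¬ Literature.Geometry.Lorentzian.IsWeaklyOuterTrapped D.h D.k f' hpb' hf' ν'; ContMDiff (𝓡 2) (𝓡 3).tangent ((⊤ : ℕ∞) : WithTop ℕ∞) (fun y ↦ (Bundle.TotalSpace.mk' Literature.Geometry.Lorentzian.E3 (S.f y) (S.ν y) : TangentBundle (𝓡 3) X)) ∧ D.SatisfiesDominantEnergyCondition ∧ e.IsAsymptoticallyFlat D 1 ∧ D.IsComplete ∧ (∃ m, e.HasADMEnergy D m) ∧ (∀ i, ∃ p, e.HasADMMomentum D i p) ∧ WOTFree S.exterior ∧ IsOutsideOf S.exterior S.surf S.f S.ν ∧ 0 < e.admMass D ∧ (letI : MeasurableSpace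 X := borel X; haveI : BorelSpace X := ⟨rfl⟩; haveI : LocallyCompactSpace X := ChartedSpace.locallyCompactSpace Literature.Geometry.Lorentzian.E3 X; (9 / 10 : ℝ) * e.admMass D ≤ Real.sqrt ((⨅ (V : TopologicalSpace.Opens X) (_ : IsCalS V ∧ V ≤ S.exterior), Literature.Geometry.Lorentzian.area D.h (frontier (V : Set X))).toReal / (16 * Real.pi))); ∀ d ∈ Literature.Geometry.Lorentzian.admissibleVacuumData X, ¬ P d → (¬ K pert d ∧ ¬ K collar d ∧ ¬ K shell d ∧ ¬ Mink d) → ¬ Hor d → ∃ (e : Literature.Geometry.Lorentzian.AFEnd X) (F : EuclideanSpace ℝ (Fin 1) → Literature.Geometry.Lorentzian.InitialDataSet (𝓡 3) X), Literature.Geometry.Lorentzian.InitialDataSet.IsTameDataFamily e 1 F ∧ Literature.Geometry.Lorentzian.InitialDataSet.IsImmersedAtZero 1 F ∧ F 0 = d ∧ Injective F ∧ (∀ c, F c ∈ Literature.Geometry.Lorentzian.admissibleVacuumData X) ∧ ∀ c ≠ 0, P (F c)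

-- parent: ExtendedFieldResidual · glue (gen 1)
/--     item stmt-FinalStateConjecture-26562 · support · rank 403 · open
    parent: ExtendedFieldResidual · GLUE: children ⟹ parent · by planner
HorizonDominatedResidual → SubPenroseResidual → ExtendedFieldResidual -/
@[route_item "route-FinalStateConjecture-RootDecompKerrBasinLadder"]
def ExtendedFieldResidualGlue : Prop :=
  HorizonDominatedResidual → SubPenroseResidual → ExtendedFieldResidual

/-- item stmt-FinalStateConjecture-25092 · crux · rank 5 · open · by planner
why it might fail: β = 1 is an absolute radius while every printed basin ε(M, χ) is inexplicit and non-uniform; data 1-close to a small-mass Kerr anchor are relatively large perturbations and may collapse further or radiate away the hole.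
sources: KlainermanSzeftel2023, arXiv:2205.14808, Hintz2026, arXiv:2104.08222
[crux] PIECE rung 0→1 — PerturbativeCapture at (s, δ, β, χ̄, ρ̄, β₀) = (6, −1, 1, 9/10, 3, 1)
[WEAKER; critic: «DECORATIVE-by-claim (β → 0⁺) / UNDECIDED[effective ε], ATTACKABLE (porting) — NOT
COUNTED»; at the typed β = 1 OPEN only by effectivity of the printed ε(M, χ) and scale
non-covariance (lens H2); leaf ATTACKABLE (porting
`klainerman_szeftel_kerr_stability_small_a_cauchy`, `hintz_kerr_stability_subextremal_cauchy`
through the lens's `onCell_of_forall_settles`) + IDEA-NEEDED (effective basin radius)]. For every Σ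
and every admissible P_Σ-exceptional datum d in the perturbative Kerr window cell (spin ratio ≤
9/10, horizon-penetrating depth, b-conormal and 1-close at order 6, weight −1, to sub-extremal Kerr
data along a cocompact embedded Kerr slice), there are one end e and a tame immersed injective
admissible one-parameter family F with F 0 = d whose members c ≠ 0 satisfy P_Σ. [difficulty: XL] -/
@[route_item "route-FinalStateConjecture-RootDecompKerrBasinLadder", crux]
def PerturbativeCapture : Prop :=
  ∀ (X : Type) [TopologicalSpace X] [ChartedSpace Literature.Geometry.Lorentzian.E3 X] [IsManifold (𝓡 3) ((⊤ : ℕ∞) : WithTop ℕ∞) X] [T2Space X] [SecondCountableTopology X] [ConnectedSpace X], let P : Literature.Geometry.Lorentzian.InitialDataSet (𝓡 3) X → Prop := fun D ↦ (∃ 𝒟 : Literature.Geometry.Lorentzian.VacuumCauchyDevelopment D, 𝒟.IsMaximal) ∧ ∀ 𝒟 : Literature.Geometry.Lorentzian.VacuumCauchyDevelopment D, 𝒟.IsMaximal → Summit.FinalStateConjecture.HasCompleteNullInfinity 𝒟.toCauchyDevelopment ∧ ∃ (O : Set 𝒟.carrier) (d : Literature.Geometry.Lorentzian.FinalStateDecomposition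 𝒟.toSpacetime O 2), (∀ i, Literature.Geometry.Lorentzian.Kerr.IsSubextremal (d.mass i) (d.spin i)) ∧ O = Summit.FinalStateConjecture.exteriorOf 𝒟.toCauchyDevelopment d.charted ∧ Summit.FinalStateConjecture.RaysStayInClosure 𝒟.toCauchyDevelopment O ∧ Summit.FinalStateConjecture.HasExhaustiveCharts d ∧ Summit.FinalStateConjecture.IsFutureOriented d; let K : Set (ℝ × ℝ) → Literature.Geometry.Lorentzian.InitialDataSet (𝓡 3) X → Prop := fun W D ↦ ∀ [Literature.Geometry.Lorentzian.Kerr.Facts] [Literature.Geometry.Lorentzian.Kerr.SliceFacts], ∃ (M a r₀ : ℝ) (hM : 0 < M), |a| < M ∧ (|a| / M, r₀ / M) ∈ W ∧ ∃ (θ : Literature.Geometry.Lorentzian.Kerr.slice a r₀ → X) (hθ : ContMDiff 𝓘(ℝ, Literature.Geometry.Lorentzian.E3) (𝓡 3) (((⊤ : ℕ∞) : WithTop ℕ∞) + 1) θ) (hθ' : ∀ u, Injective (mfderiv 𝓘(ℝ, Literature.Geometry.Lorentzian.E3) (𝓡 3) θ u)), Topology.IsOpenEmbedding θ ∧ IsCompact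 (range θ)ᶜ ∧ (∀ s' : ℕ, Literature.Geometry.Lorentzian.InitialDataSet.dataWeightedSobolevEDist s' (-1 : ℝ) (D.comap θ hθ hθ') (Literature.Geometry.Lorentzian.Kerr.data M a r₀ hM.le) < ⊤) ∧ Literature.Geometry.Lorentzian.InitialDataSet.dataWeightedSobolevEDist 6 (-1 : ℝ) (D.comap θ hθ hθ') (Literature.Geometry.Lorentzian.Kerr.data M a r₀ hM.le) < ENNReal.ofReal 1; let pert : Set (ℝ × ℝ) := {p | p.1 ≤ (9 / 10 : ℝ) ∧ 1 - Real.sqrt (1 - p.1 ^ 2) < p.2 ∧ p.2 < 1 + Real.sqrt (1 - p.1 ^ 2)}; ∀ d ∈ Literature.Geometry.Lorentzian.admissibleVacuumData X, ¬ P d → K pert d → ∃ (e : Literature.Geometry.Lorentzian.AFEnd X) (F : EuclideanSpace ℝ (Fin 1) → Literature.Geometry.Lorentzian.InitialDataSet (𝓡 3) X), Literature.Geometry.Lorentzian.InitialDataSet.IsTameDataFamily e 1 F ∧ Literature.Geometry.Lorentzian.InitialDataSet.IsImmersedAtZero 1 F ∧ F 0 = d ∧ Injective F ∧ (∀ c,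 F c ∈ Literature.Geometry.Lorentzian.admissibleVacuumData X) ∧ ∀ c ≠ 0, P (F c)

/-- item stmt-FinalStateConjecture-25093 · crux · rank 6 · open · by planner
why it might fail: no explicit Christodoulou–Klainerman radius is in print; β₀ = 1 in H^6_(−1) may exceed the true dispersive basin, letting some cell data collapse to a black hole whose settling is then the full problem.
sources: ChristodoulouKlainerman1993, arXiv:2108.13379, LindbladRodnianski2010, Bieri2009
[crux] PIECE rung 0′ — SmallDataDispersal at (s, δ, β, χ̄, ρ̄, β₀) = (6, −1, 1, 9/10, 3, 1) [WEAKER;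
critic: «same (CK93) — NOT COUNTED»; DECORATIVE in the limit β₀ → 0⁺ by
`christodoulou_klainerman_stability_minkowski_cauchy`; at β₀ = 1 open by effectivity only; leaf
ATTACKABLE (porting of gr.S07-cauchy) + effective part IDEA-NEEDED]. For every Σ and every
admissible P_Σ-exceptional datum d in the Minkowski cell (Σ globally a copy of ℝ³ via a surjective
smooth open embedding θ of the Minkowski slice, θ^*d b-conormal and 1-close at order 6, weight −1,
to the trivial data), there are one end e and a tame immersed injective admissible one-parameter
family F with F 0 = d whose members c ≠ 0 satisfy P_Σ. [difficulty: XL] -/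
@[route_item "route-FinalStateConjecture-RootDecompKerrBasinLadder", crux]
def SmallDataDispersal : Prop :=
  ∀ (X : Type) [TopologicalSpace X] [ChartedSpace Literature.Geometry.Lorentzian.E3 X] [IsManifold (𝓡 3) ((⊤ : ℕ∞) : WithTop ℕ∞) X] [T2Space X] [SecondCountableTopology X] [ConnectedSpace X], let P : Literature.Geometry.Lorentzian.InitialDataSet (𝓡 3) X → Prop := fun D ↦ (∃ 𝒟 : Literature.Geometry.Lorentzian.VacuumCauchyDevelopment D, 𝒟.IsMaximal) ∧ ∀ 𝒟 : Literature.Geometry.Lorentzian.VacuumCauchyDevelopment D, 𝒟.IsMaximal → Summit.FinalStateConjecture.HasCompleteNullInfinity 𝒟.toCauchyDevelopment ∧ ∃ (O : Set 𝒟.carrier) (d : Literature.Geometry.Lorentzian.FinalStateDecomposition 𝒟.toSpacetime O 2), (∀ i, Literature.Geometry.Lorentzian.Kerr.IsSubextremal (d.mass i) (d.spin i)) ∧ O = Summit.FinalStateConjecture.exteriorOf 𝒟.toCauchyDevelopment d.charted ∧ Summit.FinalStateConjecture.RaysStayInClosure 𝒟.toCauchyDevelopment O ∧ Summit.FinalStateConjecture.HasExhaustiveCharts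 d ∧ Summit.FinalStateConjecture.IsFutureOriented d; let Mink : Literature.Geometry.Lorentzian.InitialDataSet (𝓡 3) X → Prop := fun D ↦ ∃ (θ : Literature.Geometry.Lorentzian.Minkowski.slice → X) (hθ : ContMDiff 𝓘(ℝ, Literature.Geometry.Lorentzian.E3) (𝓡 3) (((⊤ : ℕ∞) : WithTop ℕ∞) + 1) θ) (hθ' : ∀ u, Injective (mfderiv 𝓘(ℝ, Literature.Geometry.Lorentzian.E3) (𝓡 3) θ u)), Topology.IsOpenEmbedding θ ∧ Surjective θ ∧ (∀ s' : ℕ, Literature.Geometry.Lorentzian.InitialDataSet.dataWeightedSobolevEDist s' (-1 : ℝ) (D.comap θ hθ hθ') Literature.Geometry.Lorentzian.trivialData < ⊤) ∧ Literature.Geometry.Lorentzian.InitialDataSet.dataWeightedSobolevEDist 6 (-1 : ℝ) (D.comap θ hθ hθ') Literature.Geometry.Lorentzian.trivialData < ENNReal.ofReal 1; ∀ d ∈ Literature.Geometry.Lorentzian.admissibleVacuumData X, ¬ P d → Mink d → ∃ (e : Literature.Geometry.Lorentzian.AFEnd X) (F : EuclideanSpace ℝ (Fin 1) → Literature.Geometry.Lorentzian.InitialDataSet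 (𝓡 3) X), Literature.Geometry.Lorentzian.InitialDataSet.IsTameDataFamily e 1 F ∧ Literature.Geometry.Lorentzian.InitialDataSet.IsImmersedAtZero 1 F ∧ F 0 = d ∧ Injective F ∧ (∀ c, F c ∈ Literature.Geometry.Lorentzian.admissibleVacuumData X) ∧ ∀ c ≠ 0, P (F c)

/-- item stmt-FinalStateConjecture-25094 · assembly · rank 1 · open · by planner
sources: Christodoulou1999
[assembly] PerturbativeCapture → NearExtremalCapture → EnclosedCoreCapture → SmallDataDispersal →
ExtendedFieldResidual → the final state conjecture as typed. -/
@[route_item "route-FinalStateConjecture-RootDecompKerrBasinLadder"]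
def Assembly : Prop :=
  PerturbativeCapture → NearExtremalCapture → EnclosedCoreCapture → SmallDataDispersal → ExtendedFieldResidual → FinalStateConjecture

/-! D-0027 §2.1 — DECIDING THEOREM (planner-authored via `route open/edit --closes-file`; by planner-decomp-fsc-writer-1-g0-0 2026-08-30T02:20:33Z):
its hypotheses are this route's items and its conclusion the sub-problem Statement (glue_lint), and it elaborates with this file. -/

@[closes "route-FinalStateConjecture-RootDecompKerrBasinLadder"] theorem closes (h₀ : PerturbativeCapture) (h₁ : NearExtremalCapture) (h₂ : EnclosedCoreCapture)
    (h₃ : SmallDataDispersal) (h₄ : ExtendedFieldResidual) : FinalStateConjecture := by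
  intro X _ _ _ _ _ _ d hd
  suffices h : ∃ (e : Literature.Geometry.Lorentzian.AFEnd X) (F : EuclideanSpace ℝ (Fin 1) → Literature.Geometry.Lorentzian.InitialDataSet (𝓡 3) X), Literature.Geometry.Lorentzian.InitialDataSet.IsTameDataFamily e 1 F ∧ Literature.Geometry.Lorentzian.InitialDataSet.IsImmersedAtZero 1 F ∧ F 0 = d ∧ Injective F ∧ (∀ c, F c ∈ Literature.Geometry.Lorentzian.admissibleVacuumData X) ∧ ∀ c ≠ 0, ((∃ 𝒟 : Literature.Geometry.Lorentzian.VacuumCauchyDevelopment (F c), 𝒟.IsMaximal) ∧ ∀ 𝒟 : Literature.Geometry.Lorentzian.VacuumCauchyDevelopment (F c), 𝒟.IsMaximal → Summit.FinalStateConjecture.HasCompleteNullInfinity 𝒟.toCauchyDevelopment ∧ ∃ (O : Set 𝒟.carrier) (d : Literature.Geometry.Lorentzian.FinalStateDecomposition 𝒟.toSpacetime O 2), (∀ i, Literature.Geometry.Lorentzian.Kerr.IsSubextremal (d.mass i) (d.spin i)) ∧ O = Summit.FinalStateConjecture.exteriorOf 𝒟.toCauchyDevelopment d.charted ∧ Summit.FinalStateConjecture.RaysStayInClosure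 𝒟.toCauchyDevelopment O ∧ Summit.FinalStateConjecture.HasExhaustiveCharts d ∧ Summit.FinalStateConjecture.IsFutureOriented d) by
    obtain ⟨e, F, h1, h2, h3, h4, h5, h6⟩ := h
    exact ⟨e, F, h1, h2, h3, h4, h5, fun c hc hmem ↦ hmem.2 (h6 c hc)⟩
  by_cases c₀ : ∀ [Literature.Geometry.Lorentzian.Kerr.Facts] [Literature.Geometry.Lorentzian.Kerr.SliceFacts], ∃ (M a r₀ : ℝ) (hM : 0 < M), |a| < M ∧ (|a| / M, r₀ / M) ∈ {p | p.1 ≤ (9 / 10 : ℝ) ∧ 1 - Real.sqrt (1 - p.1 ^ 2) < p.2 ∧ p.2 < 1 + Real.sqrt (1 - p.1 ^ 2)} ∧ ∃ (θ : Literature.Geometry.Lorentzian.Kerr.slice a r₀ → X) (hθ : ContMDiff 𝓘(ℝ, Literature.Geometry.Lorentzian.E3) (𝓡 3) (((⊤ : ℕ∞) : WithTop ℕ∞) + 1) θ) (hθ' : ∀ u, Injective (mfderiv 𝓘(ℝ, Literature.Geometry.Lorentzian.E3) (𝓡 3) θ u)), Topology.IsOpenEmbedding θ ∧ IsCompact (range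 θ)ᶜ ∧ (∀ s' : ℕ, Literature.Geometry.Lorentzian.InitialDataSet.dataWeightedSobolevEDist s' (-1 : ℝ) (d.comap θ hθ hθ') (Literature.Geometry.Lorentzian.Kerr.data M a r₀ hM.le) < ⊤) ∧ Literature.Geometry.Lorentzian.InitialDataSet.dataWeightedSobolevEDist 6 (-1 : ℝ) (d.comap θ hθ hθ') (Literature.Geometry.Lorentzian.Kerr.data M a r₀ hM.le) < ENNReal.ofReal 1
  · exact h₀ X d hd.1 hd.2 c₀
  by_cases c₁ : ∀ [Literature.Geometry.Lorentzian.Kerr.Facts] [Literature.Geometry.Lorentzian.Kerr.SliceFacts], ∃ (M a r₀ : ℝ) (hM : 0 < M), |a| < M ∧ (|a| / M, r₀ / M) ∈ {p | (9 / 10 : ℝ) < p.1 ∧ 1 - Real.sqrt (1 - p.1 ^ 2) < p.2 ∧ p.2 < 1 + Real.sqrt (1 - p.1 ^ 2)} ∧ ∃ (θ : Literature.Geometry.Lorentzian.Kerr.slice a r₀ → X) (hθ : ContMDiff 𝓘(ℝ, Literature.Geometry.Lorentzian.E3) (𝓡 3) (((⊤ : ℕ∞) : WithTop ℕ∞) +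 1) θ) (hθ' : ∀ u, Injective (mfderiv 𝓘(ℝ, Literature.Geometry.Lorentzian.E3) (𝓡 3) θ u)), Topology.IsOpenEmbedding θ ∧ IsCompact (range θ)ᶜ ∧ (∀ s' : ℕ, Literature.Geometry.Lorentzian.InitialDataSet.dataWeightedSobolevEDist s' (-1 : ℝ) (d.comap θ hθ hθ') (Literature.Geometry.Lorentzian.Kerr.data M a r₀ hM.le) < ⊤) ∧ Literature.Geometry.Lorentzian.InitialDataSet.dataWeightedSobolevEDist 6 (-1 : ℝ) (d.comap θ hθ hθ') (Literature.Geometry.Lorentzian.Kerr.data M a r₀ hM.le) < ENNReal.ofReal 1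
  · exact h₁ X d hd.1 hd.2 c₁
  by_cases c₂ : ∀ [Literature.Geometry.Lorentzian.Kerr.Facts] [Literature.Geometry.Lorentzian.Kerr.SliceFacts], ∃ (M a r₀ : ℝ) (hM : 0 < M), |a| < M ∧ (|a| / M, r₀ / M) ∈ {p | 1 + Real.sqrt (1 - p.1 ^ 2) ≤ p.2 ∧ p.2 ≤ 3} ∧ ∃ (θ : Literature.Geometry.Lorentzian.Kerr.slice a r₀ → X) (hθ : ContMDiff 𝓘(ℝ, Literature.Geometry.Lorentzian.E3) (𝓡 3) (((⊤ : ℕ∞) : WithTop ℕ∞) + 1) θ) (hθ' : ∀ u, Injective (mfderiv 𝓘(ℝ, Literature.Geometry.Lorentzian.E3) (𝓡 3) θ u)), Topology.IsOpenEmbedding θ ∧ IsCompact (range θ)ᶜ ∧ (∀ s' : ℕ, Literature.Geometry.Lorentzian.InitialDataSet.dataWeightedSobolevEDist s' (-1 : ℝ) (d.comap θ hθ hθ') (Literature.Geometry.Lorentzian.Kerr.data M a r₀ hM.le) < ⊤) ∧ Literature.Geometry.Lorentzian.InitialDataSet.dataWeightedSobolevEDist 6 (-1 : ℝ) (d.comap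 θ hθ hθ') (Literature.Geometry.Lorentzian.Kerr.data M a r₀ hM.le) < ENNReal.ofReal 1
  · exact h₂ X d hd.1 hd.2 c₂
  by_cases c₃ : ∃ (θ : Literature.Geometry.Lorentzian.Minkowski.slice → X) (hθ : ContMDiff 𝓘(ℝ, Literature.Geometry.Lorentzian.E3) (𝓡 3) (((⊤ : ℕ∞) : WithTop ℕ∞) + 1) θ) (hθ' : ∀ u, Injective (mfderiv 𝓘(ℝ, Literature.Geometry.Lorentzian.E3) (𝓡 3) θ u)), Topology.IsOpenEmbedding θ ∧ Surjective θ ∧ (∀ s' : ℕ, Literature.Geometry.Lorentzian.InitialDataSet.dataWeightedSobolevEDist s' (-1 : ℝ) (d.comap θ hθ hθ') Literature.Geometry.Lorentzian.trivialData < ⊤) ∧ Literature.Geometry.Lorentzian.InitialDataSet.dataWeightedSobolevEDist 6 (-1 : ℝ) (d.comap θ hθ hθ') Literature.Geometry.Lorentzian.trivialData < ENNReal.ofReal 1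
  · exact h₃ X d hd.1 hd.2 c₃
  exact h₄ X d hd.1 hd.2 ⟨c₀, c₁, c₂, c₃⟩

end Summit.FinalStateConjecture.FinalStateConjecture.Theses.RootDecompKerrBasinLadder
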